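import Literature.NumberTheory.Transcendental.CountableZilberIso
import Literature.NumberTheory.Transcendental.ZilberClassHomogeneity
import HarnessLib

/-!
# Automorphisms of Zilber fields extending isomorphisms of strong hulls (Kirby 2010 Thm 2.1 / KMO 2012 §3.5)

J. Kirby, A. Macintyre, A. Onshuus, *The algebraic numbers definable in various exponential
fields*, J. Inst. Math. Jussieu 11 (2012), §3.5, Proposition ("the key structural property of
Zilber fields"): an automorphism of a finitely generated partial E-subfield `F₀ ◁ F` of a Zilber
field `F` with CCP which contains `SK` extends to an automorphism of `F` ("quasiminimal excellence
of Zilber fields and Theorem 3.3 of Kirby, *On quasiminimal excellent classes*, JSL 75 (2010)").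
This file assembles, from the tree's proof of Zilber's categoricity theorem, the two halves of that
statement in the vocabulary of `GammaFields.lean` / `GammaIsoCross.lean`:

* `ZilberAutomorphisms.forth_over` — the forth step of Kirby's Thm 2.1 over the base `ℚτ` inside
  the closure of an ANCHOR tuple `c₀` (a copy of `ZilberPrimeModel.Covered₂.forth_tau`, whose
  ambient closed set was `ecl ∅`; engine: the cross-field `ℵ₀`-saturation
  `ZilberSaturationLog.isGammaIsoTw₂_saturation_tau'`, Bays–Kirby 2018 Lemma 8.3);
* `ZilberAutomorphisms.exists_isEIsoOn_of_isGammaIsoTw₂` — **hull to closure**: a cross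
  Γ-isomorphism `c₀ ↦ c₀'` over an isomorphism `σ₀ : ℚ^{ab}(τ₁) ≅ ℚ^{ab}(τ₂)` of standard-kernel
  bases of ONE Zilber field, between tuples spanning (with the kernel) strong subspaces, extends to
  an isomorphism of exponential fields `ecl(c₀) ≅ ecl(c₀')` (two-structure back-and-forth
  `exists_map_of_backAndForth₂` through `ZilberPrimeModel.Covered₂` with the anchor prepended);
* `ZilberAutomorphisms.ecl_eq_univ_iff_of_isEIsoOn` — isomorphic closures of finite sets are both
  or neither the whole field (relative `ecl`-rank, `IsEIsoOn₂.relRank_ecl_image_eq`);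
* `ZilberAutomorphisms.exists_equiv_of_isGammaIsoTw₂_of_countable` — **the countable case of the
  KMO Proposition in Γ-form**: in a countable Zilber field the Γ-isomorphism extends to an
  automorphism of the exponential field (the back-and-forth of `ZilberCountableIso.exists_equiv`
  over the whole field, anchored at `(c₀, c₀')`; generic partners exist by the previous two items).

Everything is proved; no named fact is introduced.

## References

* J. Kirby, A. Macintyre, A. Onshuus, J. Inst. Math. Jussieu 11 (2012) 825–834, arXiv:1101.4224:
  §3.5 Proposition.
* J. Kirby, *On quasiminimal excellent classes*, J. Symbolic Logic 75 (2010) 551–564: Thm 2.1,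
  Prop. 2.3.
* M. Bays, J. Kirby, Algebra & Number Theory 12 (2018) 493–549: Lemma 8.3, Thm 6.9.
-/

noncomputable section

open Set MvPolynomial

universe u

namespace Literature.NumberTheory.Transcendental

namespace ZilberAutomorphisms

open GammaField ZilberHomogeneity ZilberSaturationMain ZilberSaturationLog ZilberPrimeModel
  Literature.ModelTheory.ExponentialFields Literature.ModelTheory.ExponentialFields.ExponentialRing
  Literature.ModelTheory.Quasiminimal

variable {K : Type u} [Field K] [CharZero K] [ExponentialRing K]
variable {K' : Type u} [Field K'] [CharZero K'] [ExponentialRing K']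

/-! ### Forth inside the closure of an anchor tuple -/

set_option maxHeartbeats 400000 in
/-- **Forth step over `ℚτ` inside the closure of an anchor, across two fields** (Kirby 2010, proof
of Thm 2.1; Bays–Kirby 2018 Lemma 8.3 as the engine). As `ZilberPrimeModel.Covered₂.forth_tau`,
but the ambient Γ-closed `H₁` is only required to lie inside `ecl(c₀)` for an anchor tuple `c₀`
which is part of the visited tuple (so that every point of `H₁` is exponentially algebraic over
the current covering tuple). [cite: Kirby2010QMEC, Thm 2.1 (proof)]
[cite: BaysKirby2018ANT, Lemma 8.3, Def. 5.14] -/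
theorem forth_over [IsAlgClosed K'] (hsurj : IsSurjectiveOntoUnits K')
    (hSEAC : IsStronglyExpAlgClosed K')
    {τ₁ : K} (hker : expKernel K = AddSubgroup.zmultiples τ₁) (hτ : τ₁ ≠ 0) {τ₂ : K'}
    {σ₀ : fieldOf (Submodule.span ℚ ({τ₁} : Set K)) ≃+* fieldOf (Submodule.span ℚ ({τ₂} : Set K'))}
    (hσ₀ : IsEBaseIso₂ (Submodule.span ℚ ({τ₁} : Set K)) (Submodule.span ℚ ({τ₂} : Set K')) σ₀)
    {H₁ : Submodule ℚ K} {H₂ : Submodule ℚ K'} (hH₁ : IsGammaClosed H₁) (hH₂ : IsGammaClosed H₂)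
    (hKH₁ : Submodule.span ℚ {τ₁} ≤ H₁) (hKH₂ : Submodule.span ℚ {τ₂} ≤ H₂)
    {N : ℕ} {c₀ : Fin N → K} {c₀' : Fin N → K'} (hHecl : (H₁ : Set K) ⊆ ecl (range c₀))
    {n : ℕ} {x : Fin n → K} {y : Fin n → K'}
    (h : Covered₂ σ₀ H₁ H₂ (N + n) (Fin.append c₀ x) (Fin.append c₀' y)) {d : K} (hd : d ∈ H₁) :
    ∃ d' ∈ H₂, Covered₂ σ₀ H₁ H₂ (N + (n + 1)) (Fin.append c₀ (Fin.snoc x d))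
      (Fin.append c₀' (Fin.snoc y d')) := by
  classical
  obtain ⟨m, c, c', hiso, hs, hs', hcH, hc'H, hcov⟩ := h
  set D : Submodule ℚ K := Submodule.span ℚ {τ₁} ⊔ Submodule.span ℚ (range c) with hDdef
  have hDH : D ≤ H₁ := sup_le hKH₁ (Submodule.span_le.2 (by rintro _ ⟨i, rfl⟩; exact hcH i))
  have hD'H : Submodule.span ℚ {τ₂} ⊔ Submodule.span ℚ (range c') ≤ H₂ :=
    sup_le hKH₂ (Submodule.span_le.2 (by rintro _ ⟨i, rfl⟩; exact hc'H i))
  -- the anchor is part of the covering tuple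
  have hc₀c : range c₀ ⊆ range c := by
    rintro _ ⟨j, rfl⟩
    obtain ⟨i, hi, -⟩ := hcov (Fin.castAdd n j)
    exact ⟨i, by rw [hi, Fin.append_left]⟩
  -- `d` is exponentially algebraic over `D`
  have hdecl : d ∈ ecl ((D : Submodule ℚ K) : Set K) := by
    have h1 : d ∈ ecl (range c) := ecl_mono hc₀c (hHecl hd)
    exact ecl_mono (fun z hz => Submodule.mem_sup_right (Submodule.subset_span hz)) h1
  obtain ⟨n₀, x₀, ⟨i₀, hi₀⟩, hδ₀⟩ := exists_predim_le_zero_of_mem_ecl_coe D hdecl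
  -- minimise `δ` over finitely generated extensions of `D + ℚd`
  have hfgd : IsFG D (D ⊔ Submodule.span ℚ {d}) := isFG_sup_left.2 (isFG_span_of_finite D (finite_singleton d))
  obtain ⟨E, hdE, hfgE, -, hmin⟩ := hs.exists_forall_predim_le (fun _ => True) le_sup_left hfgd trivial
  have hDE : D ≤ E := le_sup_left.trans hdE
  have hdmem : d ∈ E := hdE (Submodule.mem_sup_right (Submodule.mem_span_singleton_self d))
  have hEstrong : IsStrong E :=
    isStrong_of_forall_predim_le hDE hfgE fun X hX hfgX => hmin X (hdE.trans hX) hfgX trivial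
  have hδE : predim D E = 0 := by
    refine le_antisymm ?_ (isStrong_iff.1 hs E hfgE)
    have h1 := hmin (D ⊔ Submodule.span ℚ (range x₀))
      (sup_le le_sup_left ((Submodule.span_singleton_le_iff_mem _ _).2
        (Submodule.mem_sup_right (Submodule.subset_span ⟨i₀, hi₀⟩))))
      (isFG_sup_left.2 (isFG_span_of_finite D (finite_range x₀))) trivial
    rw [predim_sup_left] at h1
    exact h1.trans hδ₀
  -- generators `e = (d, s)` of `E` over `D`
  obtain ⟨s, hsE, hEle⟩ := isFG_iff_exists_finset.1 hfgE
  set e : Fin (s.card + 1) → K := Fin.cons d fun i => (s.equivFin.symm i : K) with he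
  have he0 : e 0 = d := rfl
  have heE : ∀ i, e i ∈ E := by
    intro i
    refine Fin.cases ?_ (fun j => ?_) i
    · exact hdmem
    · simp only [he, Fin.cons_succ]
      exact hsE (s.equivFin.symm j).2
  have hDe : D ⊔ Submodule.span ℚ (range e) = E := by
    refine le_antisymm (sup_le hDE (Submodule.span_le.2 (by rintro _ ⟨i, rfl⟩; exact heE i))) ?_
    refine hEle.trans (sup_le le_sup_left ((Submodule.span_mono ?_).trans le_sup_right))
    intro z hz
    refine ⟨Fin.succ (s.equivFin ⟨z, hz⟩), ?_⟩
    simp [he]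
  have hδe : predim D (Submodule.span ℚ (range e)) = 0 := by
    rw [← predim_sup_left, hDe]; exact hδE
  -- cross saturation over `ℚτ`
  obtain ⟨e', hγ, hstr', hδ'⟩ := isGammaIsoTw₂_saturation_tau' hsurj hSEAC hker hτ hσ₀ hs hs' hiso hδe
  have hrange : Submodule.span ℚ {τ₁} ⊔ Submodule.span ℚ (range (Fin.append c e)) = E := by
    rw [ZilberHomogeneity.range_append, Submodule.span_union, ← sup_assoc, ← hDdef, hDe]
  have heH : ∀ i, e i ∈ H₁ := fun i =>
    (le_of_predim_le_zero_of_isGammaClosed hs hH₁ hDH hDE hfgE hδE.le) (heE i)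
  have he'H : ∀ i, e' i ∈ H₂ := by
    intro i
    have hfg' : IsFG (Submodule.span ℚ {τ₂} ⊔ Submodule.span ℚ (range c'))
        ((Submodule.span ℚ {τ₂} ⊔ Submodule.span ℚ (range c')) ⊔ Submodule.span ℚ (range e')) :=
      isFG_sup_left.2 (isFG_span_of_finite _ (finite_range e'))
    have hE'H : (Submodule.span ℚ {τ₂} ⊔ Submodule.span ℚ (range c')) ⊔ Submodule.span ℚ (range e') ≤ H₂ :=
      le_of_predim_le_zero_of_isGammaClosed hs' hH₂ hD'H le_sup_left hfg'
        (by rw [predim_sup_left]; exact hδ'.le)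
    exact hE'H (Submodule.mem_sup_right (Submodule.subset_span ⟨i, rfl⟩))
  refine ⟨e' 0, he'H 0, m + (s.card + 1), Fin.append c e, Fin.append c' e', hγ,
    by rw [hrange]; exact hEstrong, hstr', ?_, ?_, ?_⟩
  · intro i
    refine Fin.addCases (fun j => ?_) (fun j => ?_) i
    · simpa only [Fin.append_left] using hcH j
    · simpa only [Fin.append_right] using heH j
  · intro i
    refine Fin.addCases (fun j => ?_) (fun j => ?_) i
    · simpa only [Fin.append_left] using hc'H j
    · simpa only [Fin.append_right] using he'H j
  · intro j
    refine Fin.addCases (fun j₀ => ?_) (fun j₁ => ?_) j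
    · -- an anchor coordinate
      obtain ⟨i, hi, hi'⟩ := hcov (Fin.castAdd n j₀)
      refine ⟨Fin.castAdd (s.card + 1) i, ?_, ?_⟩
      · rw [Fin.append_left, hi, Fin.append_left, Fin.append_left]
      · rw [Fin.append_left, hi', Fin.append_left, Fin.append_left]
    · refine Fin.lastCases ?_ (fun j' => ?_) j₁
      · refine ⟨Fin.natAdd m 0, ?_, ?_⟩
        · rw [Fin.append_right, he0, Fin.append_right, Fin.snoc_last]
        · rw [Fin.append_right, Fin.append_right, Fin.snoc_last]
      · obtain ⟨i, hi, hi'⟩ := hcov (Fin.natAdd N j')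
        refine ⟨Fin.castAdd (s.card + 1) i, ?_, ?_⟩
        · rw [Fin.append_left, hi, Fin.append_right, Fin.append_right, Fin.snoc_castSucc]
        · rw [Fin.append_left, hi', Fin.append_right, Fin.append_right, Fin.snoc_castSucc]

/-! ### Hull to closure: Kirby's Theorem 2.1 over `ℚτ`, anchored, inside one Zilber field -/

/-- The Γ-subfield of the base `ℚτ` lies in the closure of any set (when `exp τ = 1`). [folklore] -/
theorem coe_fieldOf_span_singleton_subset_ecl {τ : K} (hexp : exp τ = 1) (C : Set K) :
    ((fieldOf (Submodule.span ℚ ({τ} : Set K)) : IntermediateField ℚ K) : Set K) ⊆ ecl C := by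
  have hle : Submodule.span ℚ ({τ} : Set K) ≤ Submodule.span ℚ (ecl C) :=
    (Submodule.span_singleton_le_iff_mem _ _).2 (mem_span_ecl_of_exp_eq_one hexp C)
  intro z hz
  have hz' : z ∈ fieldOf (Submodule.span ℚ (ecl C)) := fieldOf_mono hle hz
  have : z ∈ ((fieldOf (Submodule.span ℚ (ecl C)) : IntermediateField ℚ K) : Set K) := hz'
  rwa [coe_fieldOf_span_ecl] at this

set_option maxHeartbeats 800000 in
/-- **Hull to closure** (Kirby 2010, Thm 2.1 with `G = ∅`-plus-anchor, inside one Zilber field;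
the first half of the Proposition of Kirby–Macintyre–Onshuus 2012, §3.5). Let `K` be a Zilber
field, `τ₁`, `τ₂` generators of its (standard) kernel, `σ₀ : ℚ^{ab}(τ₁) ≅ ℚ^{ab}(τ₂)` an isomorphism
of the base Γ-fields, and `c₀ ↦ c₀'` a cross Γ-isomorphism over `σ₀` with `ℚτ₁ + ℚc₀ ◁ K`,
`ℚτ₂ + ℚc₀' ◁ K` (an isomorphism of the finitely generated partial E-subfields
`ℚ(ℚτ₁ + ℚc₀, exp(ℚτ₁ + ℚc₀)) ≅ ℚ(ℚτ₂ + ℚc₀', exp(…))`, both strongly embedded). Then it extends to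
an isomorphism of exponential fields `ecl(c₀) ≅ ecl(c₀')` which is `σ₀` on `ℚ^{ab}(τ₁)`. Proof: the
two-structure back-and-forth between the countable closed sets `ecl(c₀)`, `ecl(c₀')` through
`Covered₂` with the anchor prepended (`forth_over` on both sides).
[cite: Kirby2010QMEC, Thm 2.1] [cite: KirbyMacintyreOnshuus2012, §3.5 Proposition (proof sketch)]
[cite: BaysKirby2018ANT, Lemma 8.3, Thm 6.9] -/
theorem exists_isEIsoOn_of_isGammaIsoTw₂ (hK : IsZilberField K)
    {τ₁ τ₂ : K} (hker₁ : expKernel K = AddSubgroup.zmultiples τ₁)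
    (hker₂ : expKernel K = AddSubgroup.zmultiples τ₂) (hτ₁ : τ₁ ≠ 0) (hτ₂ : τ₂ ≠ 0)
    {σ₀ : fieldOf (Submodule.span ℚ ({τ₁} : Set K)) ≃+* fieldOf (Submodule.span ℚ ({τ₂} : Set K))}
    (hσ₀ : IsEBaseIso₂ (Submodule.span ℚ ({τ₁} : Set K)) (Submodule.span ℚ ({τ₂} : Set K)) σ₀)
    {N : ℕ} {c₀ c₀' : Fin N → K} (hiso : IsGammaIsoTw₂ σ₀ c₀ c₀')
    (hs : IsStrong (Submodule.span ℚ {τ₁} ⊔ Submodule.span ℚ (range c₀)))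
    (hs' : IsStrong (Submodule.span ℚ {τ₂} ⊔ Submodule.span ℚ (range c₀'))) :
    ∃ g : K → K, IsEIsoOn g (ecl (range c₀)) (ecl (range c₀')) ∧ (∀ j, g (c₀ j) = c₀' j) ∧
      ∀ k : fieldOf (Submodule.span ℚ ({τ₁} : Set K)), g k = σ₀ k := by
  classical
  haveI := hK.isAlgClosed
  have hexp₁ : exp τ₁ = 1 := exp_eq_one_of_expKernel hker₁
  have hexp₂ : exp τ₂ = 1 := exp_eq_one_of_expKernel hker₂
  -- the closures
  set H₁ : Submodule ℚ K := Submodule.span ℚ (ecl (range c₀)) with hH₁def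
  set H₂ : Submodule ℚ K := Submodule.span ℚ (ecl (range c₀')) with hH₂def
  have hH₁ : IsGammaClosed H₁ := isGammaClosed_span_ecl_univ _
  have hH₂ : IsGammaClosed H₂ := isGammaClosed_span_ecl_univ _
  have hmemH₁ : ∀ {z : K}, z ∈ H₁ ↔ z ∈ ecl (range c₀) := fun {z} => by
    rw [← SetLike.mem_coe, hH₁def, coe_span_ecl]
  have hmemH₂ : ∀ {z : K}, z ∈ H₂ ↔ z ∈ ecl (range c₀') := fun {z} => by
    rw [← SetLike.mem_coe, hH₂def, coe_span_ecl]
  have hKH₁ : Submodule.span ℚ {τ₁} ≤ H₁ :=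
    (Submodule.span_singleton_le_iff_mem _ _).2 (mem_span_ecl_of_exp_eq_one hexp₁ _)
  have hKH₂ : Submodule.span ℚ {τ₂} ≤ H₂ :=
    (Submodule.span_singleton_le_iff_mem _ _).2 (mem_span_ecl_of_exp_eq_one hexp₂ _)
  have hHecl₁ : (H₁ : Set K) ⊆ ecl (range c₀) := fun z hz => hmemH₁.1 hz
  have hHecl₂ : (H₂ : Set K) ⊆ ecl (range c₀') := fun z hz => hmemH₂.1 hz
  have hc₀H : ∀ i, c₀ i ∈ H₁ := fun i => hmemH₁.2 (subset_ecl _ ⟨i, rfl⟩)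
  have hc₀'H : ∀ i, c₀' i ∈ H₂ := fun i => hmemH₂.2 (subset_ecl _ ⟨i, rfl⟩)
  -- the relation: covered pairs with the anchor prepended
  let S : ∀ n : ℕ, (Fin n → K) → (Fin n → K) → Prop := fun n x y =>
    Covered₂ σ₀ H₁ H₂ (N + n) (Fin.append c₀ x) (Fin.append c₀' y)
  have hstart : S 0 Fin.elim0 Fin.elim0 := by
    refine ⟨N, c₀, c₀', hiso, hs, hs', hc₀H, hc₀'H, fun j => ⟨Fin.cast (Nat.add_zero N) j, ?_, ?_⟩⟩
    · rw [Fin.append_elim0]; rfl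
    · rw [Fin.append_elim0]; rfl
  have hwd : ∀ ⦃n⦄ ⦃x y : Fin n → K⦄, S n x y → ∀ i j, x i = x j ↔ y i = y j := by
    intro n x y h i j
    have := Covered₂.apply_eq_iff h (Fin.natAdd N i) (Fin.natAdd N j)
    simpa only [Fin.append_right] using this
  -- symmetry of the relation
  have hSsymm : ∀ ⦃n⦄ ⦃x y : Fin n → K⦄, S n x y →
      Covered₂ σ₀.symm H₂ H₁ (N + n) (Fin.append c₀' y) (Fin.append c₀ x) := fun n x y h =>
    Covered₂.symm h
  -- countability
  have hC₁ : ((H₁ : Set K)).Countable := countable_span_ecl hK.hasCountableClosureProperty (countable_range c₀)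
  have hC₂ : ((H₂ : Set K)).Countable := countable_span_ecl hK.hasCountableClosureProperty (countable_range c₀')
  -- the back-and-forth
  obtain ⟨g', himg, hcov⟩ := exists_map_of_backAndForth₂ (M := K) (N := K) (S := S)
    (C := (H₁ : Set K)) (C' := (H₂ : Set K)) hC₁ hC₂ hstart hwd
    (fun n x y h _ _ d hd => forth_over hK.isSurjectiveOntoUnits hK.isStronglyExpAlgClosed
      hker₁ hτ₁ hσ₀ hH₁ hH₂ hKH₁ hKH₂ hHecl₁ h hd)
    (fun n x y h _ _ d hd => by
      obtain ⟨d₀, hd₀, hcov⟩ := forth_over hK.isSurjectiveOntoUnits hK.isStronglyExpAlgClosed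
        hker₂ hτ₂ hσ₀.symm hH₂ hH₁ hKH₂ hKH₁ hHecl₂ (hSsymm h) hd
      refine ⟨d₀, hd₀, ?_⟩
      have := hcov.symm
      rwa [RingEquiv.symm_symm] at this)
  -- extracting a covering pair for finitely many points of `H₁`, remembering the anchor
  have hpair : ∀ {k : ℕ} (t : Fin k → K), (∀ i, t i ∈ H₁) →
      ∃ (m : ℕ) (c c' : Fin m → K), IsGammaIsoTw₂ σ₀ c c' ∧
        (∀ j, ∃ i, c i = t j ∧ c' i = g' (t j)) ∧ (∀ j, ∃ i, c i = c₀ j ∧ c' i = c₀' j) := by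
    intro k t ht
    obtain ⟨n₀, x, y, hS, -, -, ι, hx, hy⟩ := hcov t ht
    obtain ⟨m', c, c', hiso', -, -, -, -, hcv⟩ := hS
    refine ⟨m', c, c', hiso', fun j => ?_, fun j => ?_⟩
    · obtain ⟨i, hi, hi'⟩ := hcv (Fin.natAdd N (ι j))
      refine ⟨i, ?_, ?_⟩
      · rw [hi, Fin.append_right]; exact congrFun hx j
      · rw [hi', Fin.append_right]; exact congrFun hy j
    · obtain ⟨i, hi, hi'⟩ := hcv (Fin.castAdd n₀ j)
      exact ⟨i, by rw [hi, Fin.append_left], by rw [hi', Fin.append_left]⟩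
  -- the closures are E-subfields
  have hHadd : ∀ {u v : K}, u ∈ (H₁ : Set K) → v ∈ (H₁ : Set K) → u + v ∈ (H₁ : Set K) := by
    intro u v hu hv
    rw [SetLike.mem_coe, hmemH₁] at hu hv ⊢
    exact Khovanskii.add_mem_ecl hu hv
  have hHmul : ∀ {u v : K}, u ∈ (H₁ : Set K) → v ∈ (H₁ : Set K) → u * v ∈ (H₁ : Set K) := by
    intro u v hu hv
    rw [SetLike.mem_coe, hmemH₁] at hu hv ⊢
    exact Khovanskii.mul_mem_ecl hu hv
  have hHexp : ∀ {u : K}, u ∈ (H₁ : Set K) → exp u ∈ (H₁ : Set K) := by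
    intro u hu
    rw [SetLike.mem_coe, hmemH₁] at hu ⊢
    exact Khovanskii.exp_mem_ecl hu
  have hHset₁ : ((H₁ : Set K)) = ecl (range c₀) := by rw [hH₁def, coe_span_ecl]
  have hHset₂ : ((H₂ : Set K)) = ecl (range c₀') := by rw [hH₂def, coe_span_ecl]
  refine ⟨g', ?_, fun j => ?_, fun k => ?_⟩
  · rw [← hHset₁, ← hHset₂]
    refine ⟨⟨?_, ?_, ?_⟩, ?_, ?_, ?_⟩
    · intro z hz
      rw [← himg]; exact mem_image_of_mem g' hz
    · intro p hp q hq hpq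
      obtain ⟨m', c, c', hiso', hcv, -⟩ := hpair ![p, q] (fun i => by fin_cases i <;> assumption)
      obtain ⟨i, hi, hi'⟩ := hcv 0
      obtain ⟨j, hj, hj'⟩ := hcv 1
      simp only [Matrix.cons_val_zero, Matrix.cons_val_one] at hi hi' hj hj'
      have := (hiso'.apply_eq_iff i j).2 (by rw [hi', hj', hpq])
      rwa [hi, hj] at this
    · rw [← himg]; exact surjOn_image g' _
    · intro u v hu hv
      obtain ⟨m', c, c', hiso', hcv, -⟩ := hpair ![u, v, u + v]
        (fun i => by fin_cases i <;> [exact hu; exact hv; exact hHadd hu hv])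
      obtain ⟨i, hi, hi'⟩ := hcv 0
      obtain ⟨j, hj, hj'⟩ := hcv 1
      obtain ⟨k, hk, hk'⟩ := hcv 2
      simp only [Matrix.cons_val_zero, Matrix.cons_val_one, Matrix.head_cons, Matrix.cons_val_two,
        Matrix.tail_cons] at hi hi' hj hj' hk hk'
      have := add_eq hiso' (i := i) (j := j) (k := k) (by rw [hi, hj, hk])
      rw [hi', hj', hk'] at this
      exact this.symm
    · intro u v hu hv
      obtain ⟨m', c, c', hiso', hcv, -⟩ := hpair ![u, v, u * v]
        (fun i => by fin_cases i <;> [exact hu; exact hv; exact hHmul hu hv])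
      obtain ⟨i, hi, hi'⟩ := hcv 0
      obtain ⟨j, hj, hj'⟩ := hcv 1
      obtain ⟨k, hk, hk'⟩ := hcv 2
      simp only [Matrix.cons_val_zero, Matrix.cons_val_one, Matrix.head_cons, Matrix.cons_val_two,
        Matrix.tail_cons] at hi hi' hj hj' hk hk'
      have := mul_eq hiso' (i := i) (j := j) (k := k) (by rw [hi, hj, hk])
      rw [hi', hj', hk'] at this
      exact this.symm
    · intro u hu
      obtain ⟨m', c, c', hiso', hcv, -⟩ := hpair ![u, exp u]
        (fun i => by fin_cases i <;> [exact hu; exact hHexp hu])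
      obtain ⟨i, hi, hi'⟩ := hcv 0
      obtain ⟨k, hk, hk'⟩ := hcv 1
      simp only [Matrix.cons_val_zero, Matrix.cons_val_one] at hi hi' hk hk'
      have := exp_eq hiso' (i := i) (k := k) (by rw [hi, hk])
      rw [hi', hk'] at this
      exact this.symm
  · -- the anchor
    obtain ⟨m', c, c', hiso', hcv, hanc⟩ := hpair ![c₀ j] (fun i => by fin_cases i; exact hc₀H j)
    obtain ⟨i, hi, hi'⟩ := hcv 0
    obtain ⟨i', hi₂, hi₂'⟩ := hanc j
    simp only [Matrix.cons_val_zero] at hi hi'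
    have := (hiso'.apply_eq_iff i i').1 (by rw [hi, hi₂])
    rw [hi', hi₂'] at this
    exact this
  · -- the base
    have hkH : (k : K) ∈ H₁ := hmemH₁.2 (coe_fieldOf_span_singleton_subset_ecl hexp₁ _ k.2)
    obtain ⟨m', c, c', hiso', hcv, -⟩ := hpair ![(k : K)] (fun i => by fin_cases i; exact hkH)
    obtain ⟨i, hi, hi'⟩ := hcv 0
    simp only [Matrix.cons_val_zero] at hi hi'
    have := hiso'.eq_of_eq_coe (k := k) hi
    rw [hi'] at this
    exact this

/-! ### Isomorphic closures of finite sets exhaust the field together -/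

omit [CharZero K] in
/-- **Isomorphic closures of finite sets are both or neither the whole field.** If
`g : ecl S ≅ ecl S'` is an isomorphism of exponential fields between the closures of two finite
sets of one exponential field and `ecl S` is everything, so is `ecl S'`: `g` preserves relative
`ecl`-rank (`IsEIsoOn₂.relRank_ecl_image_eq`), so `ecl S'` is a closed set of full finite rank.
(Kirby 2010, Lemma 1.3: closed embeddings preserve the pregeometry; used in Prop. 2.3 to count
dimensions.) [cite: Kirby2010QMEC, Lemma 1.3 and Prop. 2.3 (proof)] -/
theorem ecl_eq_univ_of_isEIsoOn {g : K → K} {S S' : Set K} (hS' : S'.Finite)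
    (h : IsEIsoOn g (ecl S) (ecl S')) (hS : ecl S = univ) : ecl S' = univ := by
  have h₂ : IsEIsoOn₂ g (ecl S) (ecl S') := isEIsoOn₂_iff_isEIsoOn.2 h
  set M := (isPregeometry_ecl K).matroid with hM
  have hcl : ∀ X : Set K, M.closure X = ecl X := fun X => (isPregeometry_ecl K).matroid_closure X
  -- the rank of `ecl S` over `∅` is that of `ecl S'`
  have h1 : M.relRank ∅ (ecl S) = M.relRank ∅ (ecl S') := by
    have := h₂.relRank_ecl_image_eq (C := ∅) (X := ecl S) (empty_subset _) Subset.rfl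
    rwa [image_empty, h₂.bijOn.image_eq] at this
  -- which is finite
  have hfin : M.relRank ∅ (ecl S') < ⊤ := by
    have hc : M.relRank ∅ (ecl S') = M.relRank ∅ S' := by
      refine M.relRank_congr_closure ∅ ?_
      rw [union_empty, union_empty, hcl, hcl, Khovanskii.ecl_ecl]
    rw [hc]
    exact M.relRank_lt_top_of_finite ∅ (hS'.subset fun x hx => hx.1)
  -- the addition formula along `∅ ⊆ ecl S' ⊆ univ = ecl S`
  have hadd := M.relRank_add_relRank (empty_subset (ecl S')) (subset_univ (ecl S'))
  rw [← hS, h1] at hadd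
  have hzero : M.relRank (ecl S') (ecl S) = 0 := by
    have hne : M.relRank ∅ (ecl S') ≠ ⊤ := hfin.ne
    have : M.relRank ∅ (ecl S') + M.relRank (ecl S') (ecl S) = M.relRank ∅ (ecl S') + 0 := by
      rw [add_zero]; exact hadd
    exact WithTop.add_left_cancel hne this
  rw [M.relRank_eq_zero_iff, hS, hcl, Khovanskii.ecl_ecl] at hzero
  refine eq_univ_of_univ_subset fun z _ => hzero ⟨mem_univ z, ?_⟩
  rw [hM]; exact mem_univ z

omit [CharZero K] in
/-- Symmetric form of `ecl_eq_univ_of_isEIsoOn`. [cite: Kirby2010QMEC, Lemma 1.3] -/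
theorem ecl_eq_univ_iff_of_isEIsoOn {g : K → K} {S S' : Set K} (hS : S.Finite) (hS' : S'.Finite)
    (h : IsEIsoOn g (ecl S) (ecl S')) : ecl S = univ ↔ ecl S' = univ :=
  ⟨ecl_eq_univ_of_isEIsoOn hS' h, ecl_eq_univ_of_isEIsoOn hS h.symm⟩


/-! ### The countable case: the Γ-isomorphism extends to an automorphism -/

/-- **Forth step over the whole field, one Zilber field, both cases** (Kirby 2010, proof of
Thm 2.1 / Prop. 2.3): a pair of tuples covered by a cross Γ-isomorphism `c ↦ c'` over `σ₀` with
strong spans extends by any `d ∈ K` — by `ZilberCountableIso.forth_alg` if `d ∈ ecl(c)`, and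
otherwise by a `d' ∉ ecl(c')`, which exists because `ecl(c) ≅ ecl(c')`
(`exists_isEIsoOn_of_isGammaIsoTw₂`) and isomorphic closures of finite sets are both or neither
everything (`ecl_eq_univ_iff_of_isEIsoOn`), through the uniqueness of the generic type
(`GammaField.IsGammaIsoTw₂.append_singleton_of_not_mem`). No assumption of infinite dimension is
needed. [cite: Kirby2010QMEC, Thm 2.1 and Prop. 2.3 (proofs)]
[cite: BaysKirby2013Excellence, Prop. 5 (i)] -/
theorem forth_top' (hK : IsZilberField K)
    {τ₁ τ₂ : K} (hker₁ : expKernel K = AddSubgroup.zmultiples τ₁)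
    (hker₂ : expKernel K = AddSubgroup.zmultiples τ₂) (hτ₁ : τ₁ ≠ 0) (hτ₂ : τ₂ ≠ 0)
    {σ₀ : fieldOf (Submodule.span ℚ ({τ₁} : Set K)) ≃+* fieldOf (Submodule.span ℚ ({τ₂} : Set K))}
    (hσ₀ : IsEBaseIso₂ (Submodule.span ℚ ({τ₁} : Set K)) (Submodule.span ℚ ({τ₂} : Set K)) σ₀)
    {n : ℕ} {x y : Fin n → K} (h : Covered₂ σ₀ ⊤ ⊤ n x y) (d : K) :
    ∃ d' : K, Covered₂ σ₀ ⊤ ⊤ (n + 1) (Fin.snoc x d) (Fin.snoc y d') := by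
  classical
  haveI := hK.isAlgClosed
  have hexp₁ : exp τ₁ = 1 := exp_eq_one_of_expKernel hker₁
  have hexp₂ : exp τ₂ = 1 := exp_eq_one_of_expKernel hker₂
  obtain ⟨m, c, c', hiso, hs, hs', -, -, hcov⟩ := h
  by_cases hd : d ∈ ecl (range c)
  · -- `d` exponentially algebraic over `c`
    have hdecl : d ∈ ecl (((Submodule.span ℚ {τ₁} ⊔ Submodule.span ℚ (range c) :
        Submodule ℚ K)) : Set K) :=
      ecl_mono (fun z hz => Submodule.mem_sup_right (Submodule.subset_span hz)) hd
    obtain ⟨k, e, e', he0, hγ, hse, hse'⟩ := ZilberCountableIso.forth_alg hK.isSurjectiveOntoUnits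
      hK.isStronglyExpAlgClosed hker₁ hτ₁ hσ₀ hiso hs hs' hdecl
    refine ⟨e' 0, m + (k + 1), Fin.append c e, Fin.append c' e', hγ, hse, hse',
      fun _ => Submodule.mem_top, fun _ => Submodule.mem_top, ?_⟩
    intro j
    refine Fin.lastCases ?_ (fun j' => ?_) j
    · exact ⟨Fin.natAdd m 0, by simp [he0], by simp⟩
    · obtain ⟨i, hi, hi'⟩ := hcov j'
      exact ⟨Fin.castAdd (k + 1) i, by simp [hi], by simp [hi']⟩
  · -- `d` exponentially transcendental over `c`: a generic partner exists
    obtain ⟨d', hd'⟩ : ∃ d', d' ∉ ecl (range c') := by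
      by_contra! hall
      obtain ⟨g, hg, -, -⟩ := exists_isEIsoOn_of_isGammaIsoTw₂ hK hker₁ hker₂ hτ₁ hτ₂ hσ₀ hiso hs hs'
      have huniv : ecl (range c') = univ := eq_univ_of_forall hall
      rw [← ecl_eq_univ_iff_of_isEIsoOn (finite_range c) (finite_range c') hg] at huniv
      exact hd (huniv.symm ▸ mem_univ d)
    have hH₁ : IsGammaClosed (Submodule.span ℚ (ecl (range c))) := isGammaClosed_span_ecl_univ _
    have hH₂ : IsGammaClosed (Submodule.span ℚ (ecl (range c'))) := isGammaClosed_span_ecl_univ _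
    have hle₁ : Submodule.span ℚ {τ₁} ⊔ Submodule.span ℚ (range c) ≤ Submodule.span ℚ (ecl (range c)) :=
      sup_le ((Submodule.span_singleton_le_iff_mem _ _).2 (mem_span_ecl_of_exp_eq_one hexp₁ _))
        (Submodule.span_mono (subset_ecl _))
    have hle₂ : Submodule.span ℚ {τ₂} ⊔ Submodule.span ℚ (range c') ≤
        Submodule.span ℚ (ecl (range c')) :=
      sup_le ((Submodule.span_singleton_le_iff_mem _ _).2 (mem_span_ecl_of_exp_eq_one hexp₂ _))
        (Submodule.span_mono (subset_ecl _))
    have hdH : d ∉ Submodule.span ℚ (ecl (range c)) := by rwa [mem_span_ecl_iff]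
    have hd'H : d' ∉ Submodule.span ℚ (ecl (range c')) := by rwa [mem_span_ecl_iff]
    obtain ⟨hγ, hse, hse'⟩ := hiso.append_singleton_of_not_mem hs hs' hH₁ hH₂ hle₁ hle₂ hdH hd'H
    refine ⟨d', m + 1, Fin.append c ![d], Fin.append c' ![d'], hγ, hse, hse',
      fun _ => Submodule.mem_top, fun _ => Submodule.mem_top, ?_⟩
    intro j
    refine Fin.lastCases ?_ (fun j' => ?_) j
    · exact ⟨Fin.natAdd m 0, by simp, by simp⟩
    · obtain ⟨i, hi, hi'⟩ := hcov j'
      exact ⟨Fin.castAdd 1 i, by simp [hi], by simp [hi']⟩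

set_option maxHeartbeats 800000 in
/-- **The countable case of the KMO Proposition, Γ-form** (Kirby–Macintyre–Onshuus 2012, §3.5,
Proposition, "In particular, the statement holds for any countable Zilber field"; Kirby 2010,
Thm 2.1 / Prop. 2.3). Let `K` be a countable Zilber field, `τ₁`, `τ₂` generators of its kernel,
`σ₀ : ℚ^{ab}(τ₁) ≅ ℚ^{ab}(τ₂)` an isomorphism of base Γ-fields and `c₀ ↦ c₀'` a cross
Γ-isomorphism over `σ₀` with `ℚτ₁ + ℚc₀ ◁ K`, `ℚτ₂ + ℚc₀' ◁ K`. Then there is an automorphism of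
the exponential field `K` mapping `c₀ ↦ c₀'` which is `σ₀` on `ℚ^{ab}(τ₁)`. Proof: the
back-and-forth of `ZilberCountableIso.exists_equiv` over the whole field, anchored at
`(c₀, c₀')` (`forth_top'` on both sides). [cite: KirbyMacintyreOnshuus2012, §3.5 Proposition]
[cite: Kirby2010QMEC, Thm 2.1 and Prop. 2.3] -/
theorem exists_equiv_of_isGammaIsoTw₂_of_countable [Countable K] (hK : IsZilberField K)
    {τ₁ τ₂ : K} (hker₁ : expKernel K = AddSubgroup.zmultiples τ₁)
    (hker₂ : expKernel K = AddSubgroup.zmultiples τ₂) (hτ₁ : τ₁ ≠ 0) (hτ₂ : τ₂ ≠ 0)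
    {σ₀ : fieldOf (Submodule.span ℚ ({τ₁} : Set K)) ≃+* fieldOf (Submodule.span ℚ ({τ₂} : Set K))}
    (hσ₀ : IsEBaseIso₂ (Submodule.span ℚ ({τ₁} : Set K)) (Submodule.span ℚ ({τ₂} : Set K)) σ₀)
    {N : ℕ} {c₀ c₀' : Fin N → K} (hiso : IsGammaIsoTw₂ σ₀ c₀ c₀')
    (hs : IsStrong (Submodule.span ℚ {τ₁} ⊔ Submodule.span ℚ (range c₀)))
    (hs' : IsStrong (Submodule.span ℚ {τ₂} ⊔ Submodule.span ℚ (range c₀'))) :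
    ∃ ρ : ExponentialRingEquiv K K, (∀ j, ρ (c₀ j) = c₀' j) ∧
      ∀ k : fieldOf (Submodule.span ℚ ({τ₁} : Set K)), ρ k = σ₀ k := by
  classical
  haveI := hK.isAlgClosed
  -- the relation: covered pairs with the anchor prepended
  let S : ∀ n : ℕ, (Fin n → K) → (Fin n → K) → Prop := fun n x y =>
    Covered₂ σ₀ ⊤ ⊤ (N + n) (Fin.append c₀ x) (Fin.append c₀' y)
  have hstart : S 0 Fin.elim0 Fin.elim0 := by
    refine ⟨N, c₀, c₀', hiso, hs, hs', fun _ => Submodule.mem_top, fun _ => Submodule.mem_top,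
      fun j => ⟨Fin.cast (Nat.add_zero N) j, ?_, ?_⟩⟩
    · rw [Fin.append_elim0]; rfl
    · rw [Fin.append_elim0]; rfl
  have hwd : ∀ ⦃n⦄ ⦃x y : Fin n → K⦄, S n x y → ∀ i j, x i = x j ↔ y i = y j := by
    intro n x y h i j
    have := Covered₂.apply_eq_iff h (Fin.natAdd N i) (Fin.natAdd N j)
    simpa only [Fin.append_right] using this
  -- the back-and-forth over the whole (countable) field
  obtain ⟨g', himg, hcov⟩ := exists_map_of_backAndForth₂ (M := K) (N := K) (S := S)
    (C := (univ : Set K)) (C' := (univ : Set K)) countable_univ countable_univ hstart hwd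
    (fun n x y h _ _ d _ => by
      obtain ⟨d', h'⟩ := forth_top' hK hker₁ hker₂ hτ₁ hτ₂ hσ₀ h d
      refine ⟨d', mem_univ _, ?_⟩
      show Covered₂ σ₀ ⊤ ⊤ (N + (n + 1)) (Fin.append c₀ (Fin.snoc x d)) (Fin.append c₀' (Fin.snoc y d'))
      rw [Fin.append_snoc, Fin.append_snoc]
      exact h')
    (fun n x y h _ _ d _ => by
      obtain ⟨d₀, hcov⟩ := forth_top' hK hker₂ hker₁ hτ₂ hτ₁ hσ₀.symm (Covered₂.symm h) d
      refine ⟨d₀, mem_univ _, ?_⟩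
      have := hcov.symm
      rw [RingEquiv.symm_symm] at this
      show Covered₂ σ₀ ⊤ ⊤ (N + (n + 1)) (Fin.append c₀ (Fin.snoc x d₀)) (Fin.append c₀' (Fin.snoc y d))
      rw [Fin.append_snoc, Fin.append_snoc]
      exact this)
  -- extracting a covering pair for finitely many points, remembering the anchor
  have hpair : ∀ {k : ℕ} (t : Fin k → K),
      ∃ (m : ℕ) (c c' : Fin m → K), IsGammaIsoTw₂ σ₀ c c' ∧
        (∀ j, ∃ i, c i = t j ∧ c' i = g' (t j)) ∧ (∀ j, ∃ i, c i = c₀ j ∧ c' i = c₀' j) := by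
    intro k t
    obtain ⟨n₀, x, y, hS, -, -, ι, hx, hy⟩ := hcov t (fun _ => mem_univ _)
    obtain ⟨m', c, c', hiso', -, -, -, -, hcv⟩ := hS
    refine ⟨m', c, c', hiso', fun j => ?_, fun j => ?_⟩
    · obtain ⟨i, hi, hi'⟩ := hcv (Fin.natAdd N (ι j))
      refine ⟨i, ?_, ?_⟩
      · rw [hi, Fin.append_right]; exact congrFun hx j
      · rw [hi', Fin.append_right]; exact congrFun hy j
    · obtain ⟨i, hi, hi'⟩ := hcv (Fin.castAdd n₀ j)
      exact ⟨i, by rw [hi, Fin.append_left], by rw [hi', Fin.append_left]⟩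
  -- the map preserves `0, 1, +, ·, exp`
  have hone : g' 1 = 1 := by
    obtain ⟨m', c, c', hiso', hcv, -⟩ := hpair ![(1 : K)]
    obtain ⟨i, hi, hi'⟩ := hcv 0
    simp only [Matrix.cons_val_zero] at hi hi'
    rw [← hi']
    exact eq_one hiso' hi
  have hzero : g' 0 = 0 := by
    obtain ⟨m', c, c', hiso', hcv, -⟩ := hpair ![(0 : K)]
    obtain ⟨i, hi, hi'⟩ := hcv 0
    simp only [Matrix.cons_val_zero] at hi hi'
    rw [← hi']
    exact eq_zero hiso' hi
  have hadd : ∀ u v : K, g' (u + v) = g' u + g' v := by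
    intro u v
    obtain ⟨m', c, c', hiso', hcv, -⟩ := hpair ![u, v, u + v]
    obtain ⟨i, hi, hi'⟩ := hcv 0
    obtain ⟨j, hj, hj'⟩ := hcv 1
    obtain ⟨k, hk, hk'⟩ := hcv 2
    simp only [Matrix.cons_val_zero, Matrix.cons_val_one, Matrix.head_cons, Matrix.cons_val_two,
      Matrix.tail_cons] at hi hi' hj hj' hk hk'
    have := add_eq hiso' (i := i) (j := j) (k := k) (by rw [hi, hj, hk])
    rw [hi', hj', hk'] at this
    exact this.symm
  have hmul : ∀ u v : K, g' (u * v) = g' u * g' v := by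
    intro u v
    obtain ⟨m', c, c', hiso', hcv, -⟩ := hpair ![u, v, u * v]
    obtain ⟨i, hi, hi'⟩ := hcv 0
    obtain ⟨j, hj, hj'⟩ := hcv 1
    obtain ⟨k, hk, hk'⟩ := hcv 2
    simp only [Matrix.cons_val_zero, Matrix.cons_val_one, Matrix.head_cons, Matrix.cons_val_two,
      Matrix.tail_cons] at hi hi' hj hj' hk hk'
    have := mul_eq hiso' (i := i) (j := j) (k := k) (by rw [hi, hj, hk])
    rw [hi', hj', hk'] at this
    exact this.symm
  have hexpmap : ∀ u : K, g' (exp u) = exp (g' u) := by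
    intro u
    obtain ⟨m', c, c', hiso', hcv, -⟩ := hpair ![u, exp u]
    obtain ⟨i, hi, hi'⟩ := hcv 0
    obtain ⟨k, hk, hk'⟩ := hcv 1
    simp only [Matrix.cons_val_zero, Matrix.cons_val_one] at hi hi' hk hk'
    have := exp_eq hiso' (i := i) (k := k) (by rw [hi, hk])
    rw [hi', hk'] at this
    exact this.symm
  let φ : ExponentialRingHom K K :=
    { toFun := g'
      map_one' := hone
      map_mul' := hmul
      map_zero' := hzero
      map_add' := hadd
      map_exp' := fun u => by exact hexpmap u }
  have hφ : ∀ z, φ z = g' z := fun _ => rfl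
  have hsurjφ : Function.Surjective φ.toRingHom := by
    intro w
    have hw : w ∈ g' '' (univ : Set K) := by rw [himg]; exact mem_univ w
    obtain ⟨z, -, rfl⟩ := hw
    exact ⟨z, rfl⟩
  have hbij : Function.Bijective φ.toRingHom := ⟨φ.toRingHom.injective, hsurjφ⟩
  let ρ : ExponentialRingEquiv K K :=
    { toRingEquiv := RingEquiv.ofBijective φ.toRingHom hbij
      map_exp' := fun u => by exact hexpmap u }
  have hρ : ∀ z, ρ z = g' z := fun _ => rfl
  refine ⟨ρ, fun j => ?_, fun k => ?_⟩
  · -- the anchor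
    rw [hρ]
    obtain ⟨m', c, c', hiso', hcv, hanc⟩ := hpair ![c₀ j]
    obtain ⟨i, hi, hi'⟩ := hcv 0
    obtain ⟨i', hi₂, hi₂'⟩ := hanc j
    simp only [Matrix.cons_val_zero] at hi hi'
    have := (hiso'.apply_eq_iff i i').1 (by rw [hi, hi₂])
    rw [hi', hi₂'] at this
    exact this
  · -- the base
    rw [hρ]
    obtain ⟨m', c, c', hiso', hcv, -⟩ := hpair ![(k : K)]
    obtain ⟨i, hi, hi'⟩ := hcv 0
    simp only [Matrix.cons_val_zero] at hi hi'
    have := hiso'.eq_of_eq_coe (k := k) hi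
    rw [hi'] at this
    exact this

end ZilberAutomorphisms

end Literature.NumberTheory.Transcendental
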